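import Literature.Probability.Percolation.SlabRSWGluingExtB
import Literature.Probability.Percolation.SlabRSWGluingFactTwo
import Literature.Probability.Percolation.SlabRSWGluingFactOne
import HarnessLib

/-!
# Newman–Tassion–Wu 2017, §3.2, proof of Theorem 3.7, step (1)–(3) AT A PRESCRIBED ENTRY CELL —
# the plain rerouting surgery of the extended rectangle from PORT DATA (the geometric half of Fact 2,
# first case)

Topic: `Literature/Probability/Percolation`. The high-probability regime of NTW's gluing lemma
(`NTW17.glue_highProb_of_gadgets_ent`, `SlabRSWGluingHighProbGlue.lean`) needs a located gadget
(`NTW17.GadgetAt`) at EVERY entry cell of `U_ent(ω)` (`GlueData.Uent`), not only at the first contact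
of one open path from `C̄` (which is what `exists_surgery_ext` / `exists_gadget_ext` provide). An entry
cell `y` comes with PORT DATA: a vertex `v` over `y` within `ρ` of `Γ̄`, a lattice neighbour `u` of `v`
NOT within `ρ` of `Γ̄`, and an `ω`-open self-avoiding path from `C̄` to `u` inside `R̄` running off the
`ρ`-neighbourhood of `Γ̄` — the entry edge `{u, v}` itself need not be open (NTW, p. 10: the far end
`w′` of the branch is only required to carry "an open self-avoiding path `π` from `w′` to `C`"; the
branch `γ_w` is opened by the surgery).  This file re-runs the tree's `exists_surgery_ext` (p2 GEN 40)
from such port data in its first case (cleared box left of the target column `x = b`, no cell of `A`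
or `C` within `ρ + 3`): the port of the surgery is found on the far path by `exists_entry`, and
`exists_surgery_of_route` — which takes port data — does the rest verbatim.

* `NTW17.exists_surgery_ext_at` — PROVED; `NTW17.gadgetAt_of_surgery` (a surgery with cleared set in
  `y + B_r` is a located gadget of type `att`).

What remains for the full supply `∀ y ∈ U_ent(ω), ∃ ω', GadgetAt …` in the `ExtSetup` geometry: the
same re-run for `exists_surgeryB_ext` (box reaching `x = b`) and `exists_directGlue_A_ext` (a cell of
`A` within `ρ + 3`), and the entry cells just outside `R` (centre the box at the far vertex `u`).

## Sources

* C. M. Newman, V. Tassion, W. Wu, *Critical percolation and the minimal spanning tree in slabs*,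
  Comm. Pure Appl. Math. 70 (2017), arXiv:1512.09107: §3.2, proof of Theorem 3.7, steps (1)–(3) and
  Fact 2 ("For any `z ∈ U(ω)` … we will construct a new configuration `ω^{(z)}`", p. 10) [NewmanTassionWu2017].
-/

noncomputable section

namespace Literature.Probability.Percolation

open MeasureTheory LatticeModels SimpleGraph

namespace NTW17

variable {k : ℕ}

section At

variable {E : ExtSetup} {ω : BondConfig (slab 3 k)} {ρ : ℕ}

/-- **The plain surgery at a prescribed entry cell, from port data** (`S ⊊ R`, box left of `x = b`):
given `v ∈ R̄` within `ρ` of `Γ̄`, a lattice neighbour `u` of `v` not within `ρ` of `Γ̄`, an `ω`-open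
self-avoiding path from `c₀ ∈ C̄` to `u` inside `R̄` off the `ρ`-neighbourhood of `Γ̄`, no cell of `A`
or `C` within `ρ + 3` of `z = planar v` and `z.1 + ρ + 3 ≤ b - 1`, there is a surgery whose cleared set
is inside `z + B_{ρ+3}`. [cite: NewmanTassionWu2017, §3.2 (proof of Theorem 3.7, steps (1)–(3); Fact 2, ω^{(z)} for z ∈ U(ω))] -/
theorem exists_surgery_ext_at (hk : 1 ≤ k) (hρ : 2 ≤ ρ) (hω : ω ⊆ (slabGraph 3 k).edgeSet)
    (hX : ω ∈ E.Q.evX k) {c₀ u v : slab 3 k} {L : List (slab 3 k)} (hc₀ : c₀ ∈ slabLift k E.C)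
    (hL : IsOSAP k ω (slabLift k E.R ∩ {x | ¬Near k (E.Q.γ k ω) ρ (planar k x)}) {c₀} {u} L)
    (huv : (slabGraph 3 k).Adj u v) (hvR : v ∈ slabLift k E.R)
    (hnear : Near k (E.Q.γ k ω) ρ (planar k v))
    (hnA : ∀ a' ∈ E.A, a' ∉ sqBox (planar k v) (ρ + 3))
    (hnC : ∀ c' ∈ E.C, c' ∉ sqBox (planar k v) (ρ + 3))
    (hcol : (planar k v).1 + (ρ + 3) ≤ E.b - 1) :
    ∃ sx : E.Q.Surgery k ω, sx.D ⊆ sqBox (planar k v) (ρ + 3) := by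
  have hA : ω ∈ E.Q.evAB k := hX.1
  obtain ⟨hγO, -⟩ := E.Q.γ_spec hA
  set z := planar k v with hzdef
  set r : ℕ := ρ + 3 with hrdef
  set D := E.Dbox z r with hDdef
  set K := E.Kbox z r with hKdef
  set Kp := E.Kplus z r with hKpdef
  have hzR : z ∈ E.R := hvR
  obtain ⟨hz1, hz2, hz3, hz4⟩ := contact_bounds hA hzR hnear
  have hzR' := hzR
  rw [ExtSetup.mem_R_iff] at hzR'
  have hab := E.hab; have hcd := E.hcd; have hbb' := E.hbb'; have hdd' := E.hdd'
  have hDz : D ⊆ sqBox z (ρ + 3) := ExtSetup.Dbox_subset_sqBox _ _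
  have hzD : z ∈ D := ExtSetup.mem_Dbox_iff.2 ⟨hzR, mem_sqBox_self _ _⟩
  have hc₀D : planar k c₀ ∉ D := fun h => hnC _ hc₀ (hDz h)
  have hDA : ∀ w ∈ D, w ∉ E.Q.A := fun w hw hwA => hnA w hwA (hDz hw)
  have hDKp : D ⊆ Kp := by
    intro w hw
    rw [ExtSetup.mem_Dbox_iff] at hw
    rw [ExtSetup.mem_Kplus_iff]
    refine ⟨hw.1, hw.2, ?_⟩
    have := (mem_sqBox_iff'.1 hw.2).2.1
    omega
  have hDB : ∀ w ∈ D, w ∉ E.Q.B := fun w hw => ExtSetup.Kplus_disjoint_B (hDKp hw)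
  -- the port: the first entry of the far path into `D̄` (`u`, its last vertex, lies over `D`)
  have huL : u ∈ L := by
    have := hL.last_mem hL.ne_nil
    rw [Set.mem_singleton_iff] at this
    rw [← this]; exact List.getLast_mem _
  have huD : planar k u ∈ D := by
    refine ExtSetup.mem_Dbox_iff.2 ⟨(hL.subset u huL).1, sqBox_mono _ (by omega : 1 ≤ r) ?_⟩
    exact planar_mem_sqBox_one_of_adj huv.symm
  have hheadL : L.head hL.ne_nil = c₀ := by
    have := hL.head_mem hL.ne_nil
    rwa [Set.mem_singleton_iff] at this
  have hheadD : planar k (L.head hL.ne_nil) ∉ D := by rw [hheadL]; exact hc₀D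
  obtain ⟨m, w', rest, hm, hLeq, hmD, hw'D, hedge, -, hmhead, hconn, -⟩ :=
    exists_entry (R := E.R) hL.chain hL.nodup (fun x hx => (hL.subset x hx).1) hL.ne_nil hheadD
      ⟨u, huL, huD⟩
  rw [hheadL] at hconn
  set q₁ := m.getLast hm with hq₁
  have hadj : (slabGraph 3 k).Adj w' q₁ := ((SimpleGraph.mem_edgeSet _).1 (hω hedge)).symm
  have hq₁D : planar k q₁ ∉ D := hmD _ (List.getLast_mem hm)
  have hσ : ω ∈ openConnIn (slabLift k (E.Q.R \ D)) q₁ c₀ := openConnIn_reverse hconn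
  have hw'L : w' ∈ L := by rw [hLeq]; simp
  have hw'far : ¬Near k (E.Q.γ k ω) ρ (planar k w') := (hL.subset w' hw'L).2
  -- two vertices of `γ` over `D`: `g₀` and its predecessor
  obtain ⟨g₀, hg₀, hz⟩ := hnear
  have hg₀z : planar k g₀ ∈ sqBox z ρ := GlueGeom.mem_sqBox_comm hz
  have hg₀h := ne_head_of_far_A (Q := E.Q) hA hz (by omega : ρ ≤ ρ + 3) hnA
  obtain ⟨g₁, hg₁γ, hadj₀, hg₁ne, -⟩ := exists_pred hω hA hg₀ hg₀h
  have hg₀D : planar k g₀ ∈ D :=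
    ExtSetup.mem_Dbox_iff.2 ⟨E.S_subset_R (hγO.subset g₀ hg₀), sqBox_mono _ (by omega) hg₀z⟩
  have hg₁D : planar k g₁ ∈ D := by
    refine ExtSetup.mem_Dbox_iff.2 ⟨E.S_subset_R (hγO.subset g₁ hg₁γ), sqBox_mono _ (by omega : ρ + 1 ≤ r) ?_⟩
    exact mem_sqBox_add hg₀z (planar_mem_sqBox_one_of_adj hadj₀.symm)
  have htwo : ∃ x ∈ E.Q.γ k ω, ∃ y ∈ E.Q.γ k ω, x ≠ y ∧ planar k x ∈ D ∧ planar k y ∈ D :=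
    ⟨g₁, hg₁γ, g₀, hg₀, hg₁ne, hg₁D, hg₀D⟩
  -- a vertex of `γ` over `D` lies over the trunk box
  have hγK : ∀ x ∈ E.Q.γ k ω, planar k x ∈ D → planar k x ∈ K := by
    intro x hx hxD
    have hxS : planar k x ∈ E.S := hγO.subset x hx
    refine ExtSetup.mem_Kbox_of hxS (hDz hxD) ?_
    have := (mem_sqBox_iff'.1 (hDz hxD)).2.1
    omega
  -- routing: trunk in `K`, branch in `Kp`
  have hroute : ∀ E₁ E₂ : slab 3 k, E₁ ∈ E.Q.γ k ω → E₂ ∈ E.Q.γ k ω → E₁ ≠ E₂ →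
      planar k E₁ ∈ D → planar k E₂ ∈ D → ∃ Lr Br c, RouteSpec k K D E₁ E₂ w' Lr Br c := by
    intro E₁ E₂ hE₁ hE₂ hne hE₁D hE₂D
    have h1 : ¬Near k (E.Q.γ k ω) 0 (planar k w') := fun hn => hw'far (hn.mono (by omega))
    obtain ⟨Lr, Br, c, spec⟩ := exists_route (xL := max E.a (z.1 - (r : ℕ)))
      (xR' := min (E.b - 1) (z.1 + (r : ℕ))) (xR := min (E.b - 1) (z.1 + (r : ℕ)))
      (rB := max E.c (z.2 - (r : ℕ))) (rP := min E.d (z.2 + (r : ℕ))) (rT := min E.d' (z.2 + (r : ℕ)))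
      hk (by omega) le_rfl (by omega) (by omega) (hγK E₁ hE₁ hE₁D) (hγK E₂ hE₂ hE₂D)
      (hDKp hw'D) hne (ne_planar_of_not_near h1 hE₁).symm (ne_planar_of_not_near h1 hE₂).symm
    exact ⟨Lr, Br, c, RouteSpec.mono spec subset_rfl (ExtSetup.Kplus_subset_Dbox _ _)⟩
  obtain ⟨sx, hsx⟩ := exists_surgery_of_route (Q := E.Q) hX (D := D) (Dt := K)
    (ExtSetup.Dbox_subset_R _ _) hDA hDB (ExtSetup.Kbox_subset_Dbox _ _) (ExtSetup.Kbox_subset_S _ _)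
    htwo hadj hq₁D hc₀ hσ hroute
  exact ⟨sx, hsx ▸ hDz⟩

/-- **A rerouting surgery with cleared set inside `y + B_r` is a located gadget at `y`** (type `att`).
[cite: NewmanTassionWu2017, §3.2 (proof of Theorem 3.7, Fact 2: "z … can be uniquely determined")] -/
theorem gadgetAt_of_surgery {Q : GlueData} {r : ℕ} {y : ℤ × ℤ} (hX : ω ∈ Q.evX k)
    (sx : Q.Surgery k ω) (hD : sx.D ⊆ sqBox y r) : GadgetAt Q k r ω sx.newConfig y :=
  ⟨sx.newConfig_mem_evCA hX, fun _ he => sx.mem_window hX.1 he,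
    ⟨sx.D, fun _ he => sx.agree_off_touch he, hD, 0, by
      simpa [statOf] using sx.att_nonempty hX, by simpa [statOf] using sx.att_subset hX⟩⟩

end At

section AtA

variable {E : ExtSetup} {ω : BondConfig (slab 3 k)} {ρ : ℕ}

/-- **Direct gluing near `A` at a prescribed entry cell, from port data**: if a cell of `A` is within
`ρ + 3` of `z = planar v`, the far path from `c₀ ∈ C̄` to `u` (a lattice neighbour of `v`) enters the box
`(z + B_{ρ+3}) ∩ R`, and the `C`-cluster is glued to `Ā` inside it (the entry edge `{u, v}` is not used).
[cite: NewmanTassionWu2017, §3.2 (proof of Theorem 3.7, steps (2)–(3), near A; Fact 2, ω^{(z)})] -/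
theorem exists_directGlue_A_ext_at (hω : ω ⊆ (slabGraph 3 k).edgeSet) (hX : ω ∈ E.Q.evX k)
    (hsep : ∀ a' ∈ E.A, ∀ c' ∈ E.C, c' ∉ sqBox a' (4 * ρ + 8))
    {c₀ u v : slab 3 k} {L : List (slab 3 k)} (hc₀ : c₀ ∈ slabLift k E.C)
    (hL : IsOSAP k ω (slabLift k E.R ∩ {x | ¬Near k (E.Q.γ k ω) ρ (planar k x)}) {c₀} {u} L)
    (huv : (slabGraph 3 k).Adj u v) (hvR : v ∈ slabLift k E.R)
    (hA' : ∃ a' ∈ E.A, a' ∈ sqBox (planar k v) (ρ + 3)) :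
    ∃ dg : DirectGlue k E.R E.C E.A ω, dg.D ⊆ sqBox (planar k v) (ρ + 3) := by
  set z := planar k v with hzdef
  set D := E.Dbox z (ρ + 3) with hDdef
  obtain ⟨a', ha', ha'z⟩ := hA'
  have hzR : z ∈ E.R := hvR
  have hDC : ∀ w ∈ D, w ∉ E.C := by
    intro w hw hwC
    have hwz := ExtSetup.Dbox_subset_sqBox _ _ hw
    have : w ∈ sqBox a' ((ρ + 3) + (ρ + 3)) := mem_sqBox_add (GlueGeom.mem_sqBox_comm ha'z) hwz
    exact hsep a' ha' w hwC (sqBox_mono _ (by omega) this)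
  have hc₀D : planar k c₀ ∉ D := fun h => hDC _ h hc₀
  have huL : u ∈ L := by
    have := hL.last_mem hL.ne_nil
    rw [Set.mem_singleton_iff] at this
    rw [← this]; exact List.getLast_mem _
  have huD : planar k u ∈ D := by
    refine ExtSetup.mem_Dbox_iff.2 ⟨(hL.subset u huL).1, sqBox_mono _ (by omega : 1 ≤ ρ + 3) ?_⟩
    exact planar_mem_sqBox_one_of_adj huv.symm
  have hheadL : L.head hL.ne_nil = c₀ := by
    have := hL.head_mem hL.ne_nil
    rwa [Set.mem_singleton_iff] at this
  have hheadD : planar k (L.head hL.ne_nil) ∉ D := by rw [hheadL]; exact hc₀D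
  obtain ⟨m, w', rest, hm, hLeq, hmD, hw'D, hedge, -, -, hconn, -⟩ :=
    exists_entry (R := E.R) hL.chain hL.nodup (fun x hx => (hL.subset x hx).1) hL.ne_nil hheadD
      ⟨u, huL, huD⟩
  rw [hheadL] at hconn
  have hadj : (slabGraph 3 k).Adj (m.getLast hm) w' := (SimpleGraph.mem_edgeSet _).1 (hω hedge)
  have hw'L : w' ∈ L := by rw [hLeq]; simp
  -- `w'` is joined to `c₀ ∈ C̄` inside `R̄`: it cannot lie over `A` (else `C ⟷^R A`)
  have hw'A : planar k w' ∉ E.A := by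
    intro hA'
    have hj := hL.openConnIn_of_mem hw'L
    rw [hheadL] at hj
    exact hX.2 ⟨c₀, hc₀, w', hA', openConnIn_mono (Set.inter_subset_left) _ _ hj⟩
  have ha'D : a' ∈ D := ExtSetup.mem_Dbox_iff.2 ⟨E.S_subset_R (E.hA ha'), ha'z⟩
  obtain ⟨dg, hdg⟩ := exists_directGlue (R := E.R) (Src := E.C) (Tg := E.A)
    (ExtSetup.Dbox_subset_R _ _) hDC hc₀ (hmD _ (List.getLast_mem hm)) hconn hadj hw'D hw'A ha'D ha'
  exact ⟨dg, hdg ▸ ExtSetup.Dbox_subset_sqBox _ _⟩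

/-- A direct gluing of the `C`-cluster to `Ā` with cleared set inside `y + B_r` is a located gadget at `y`
(type `attT(C → A)`). [cite: NewmanTassionWu2017, §3.2 (proof of Theorem 3.7)] -/
theorem gadgetAt_of_directGlue_A {Q : GlueData} {r : ℕ} {y : ℤ × ℤ} (hX : ω ∈ Q.evX k)
    (dg : DirectGlue k Q.R Q.C Q.A ω) (hD : dg.D ⊆ sqBox y r) : GadgetAt Q k r ω dg.newConfig y :=
  ⟨dg.newConfig_mem hX.2, fun _ he => dg.mem_window he,
    ⟨dg.D, fun _ he => dg.agree_off_touch he, hD, 1, by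
      simpa [statOf] using dg.attT_nonempty hX.2, by simpa [statOf] using dg.attT_subset hX.2⟩⟩

end AtA

section AtB

variable {E : ExtSetup} {ω : BondConfig (slab 3 k)} {ρ : ℕ}

/-- **The `B`-reaching surgery at a prescribed entry cell, from port data** (`S ⊊ R`, cleared box
reaching the target column `x = b`): as `exists_surgeryB_ext`, but the contact is given by PORT DATA —
an `ω`-open self-avoiding path from `c₀ ∈ C̄` to `wfar` inside `R̄` off the `ρ`-neighbourhood of `Γ̄` and a
lattice neighbour `vnear ∈ R̄` of `wfar` within `ρ` of `Γ̄` (the entry edge need not be open); the port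
of the surgery is the first entry of the far path into the cleared box.
[cite: NewmanTassionWu2017, §3.2 (proof of Theorem 3.7, steps (1)–(3); Fact 2, ω^{(z)} for z ∈ U(ω))] -/
theorem exists_surgeryB_ext_at (hk : 1 ≤ k) (hρ : 2 ≤ ρ) (hω : ω ⊆ (slabGraph 3 k).edgeSet)
    (hX : ω ∈ E.Q.evX k) {c₀ wfar vnear : slab 3 k} {Lfar : List (slab 3 k)} (hc₀ : c₀ ∈ slabLift k E.C)
    (hLfar : IsOSAP k ω (slabLift k E.R ∩ {x | ¬Near k (E.Q.γ k ω) ρ (planar k x)}) {c₀} {wfar} Lfar)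
    (hwv : (slabGraph 3 k).Adj wfar vnear) (hvR : vnear ∈ slabLift k E.R)
    (hnear : Near k (E.Q.γ k ω) ρ (planar k vnear))
    (hnA : ∀ a' ∈ E.A, a' ∉ sqBox (planar k vnear) (ρ + 3))
    (hnC : ∀ c' ∈ E.C, c' ∉ sqBox (planar k vnear) (ρ + 3))
    (hcol : E.b ≤ (planar k vnear).1 + (ρ + 3)) :
    ∃ sb : E.Q.SurgeryB k ω, sb.D ⊆ sqBox (planar k vnear) (ρ + 3) := by
  have hA : ω ∈ E.Q.evAB k := hX.1
  obtain ⟨hγO, -⟩ := E.Q.γ_spec hA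
  set z := planar k vnear with hzdef
  set r : ℕ := ρ + 3 with hrdef
  set D := E.Dbox z r with hDdef
  set K := E.Kbox z r with hKdef
  set Kp := E.Kplus z r with hKpdef
  have hzR : z ∈ E.R := hvR
  obtain ⟨hz1, hz2, hz3, hz4⟩ := contact_bounds hA hzR hnear
  have hzR' := hzR
  rw [ExtSetup.mem_R_iff] at hzR'
  have hab := E.hab; have hcd := E.hcd; have hbb' := E.hbb'; have hdd' := E.hdd'
  have hDz : D ⊆ sqBox z (ρ + 3) := ExtSetup.Dbox_subset_sqBox _ _
  have hKD : K ⊆ D := ExtSetup.Kbox_subset_Dbox _ _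
  have hKpD : Kp ⊆ D := ExtSetup.Kplus_subset_Dbox _ _
  have hKKp : K ⊆ Kp := ExtSetup.Kbox_subset_Kplus _ _
  have hzD : z ∈ D := ExtSetup.mem_Dbox_iff.2 ⟨hzR, mem_sqBox_self _ _⟩
  have hc₀D : planar k c₀ ∉ D := fun h => hnC _ hc₀ (hDz h)
  have hDA : ∀ w ∈ D, w ∉ E.Q.A := fun w hw hwA => hnA w hwA (hDz hw)
  -- membership criteria
  have memK : ∀ w : ℤ × ℤ, E.a ≤ w.1 → w.1 ≤ E.b - 1 → z.1 - r ≤ w.1 → w.1 ≤ z.1 + r →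
      E.c ≤ w.2 → w.2 ≤ E.d → z.2 - r ≤ w.2 → w.2 ≤ z.2 + r → w ∈ K := by
    intro w h1 h2 h3 h4 h5 h6 h7 h8
    rw [ExtSetup.mem_Kbox_iff, ExtSetup.mem_S_iff, mem_sqBox_iff']
    exact ⟨⟨h1, by omega, h5, h6⟩, ⟨h3, h4, h7, h8⟩, by omega⟩
  have memD : ∀ w : ℤ × ℤ, w ∈ D → E.a ≤ w.1 ∧ w.1 ≤ E.b' ∧ z.1 - r ≤ w.1 ∧ w.1 ≤ z.1 + r ∧
      E.c ≤ w.2 ∧ w.2 ≤ E.d' ∧ z.2 - r ≤ w.2 ∧ w.2 ≤ z.2 + r := by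
    intro w hw
    rw [ExtSetup.mem_Dbox_iff, ExtSetup.mem_R_iff, mem_sqBox_iff'] at hw
    omega
  have memD' : ∀ w : ℤ × ℤ, E.a ≤ w.1 → w.1 ≤ E.b' → z.1 - r ≤ w.1 → w.1 ≤ z.1 + r →
      E.c ≤ w.2 → w.2 ≤ E.d' → z.2 - r ≤ w.2 → w.2 ≤ z.2 + r → w ∈ D := by
    intro w h1 h2 h3 h4 h5 h6 h7 h8
    rw [ExtSetup.mem_Dbox_iff, ExtSetup.mem_R_iff, mem_sqBox_iff']
    exact ⟨⟨h1, h2, h5, h6⟩, ⟨h3, h4, h7, h8⟩⟩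
  have notK_b : ∀ w : ℤ × ℤ, E.b ≤ w.1 → w ∉ K := by
    intro w hw h
    rw [ExtSetup.mem_Kbox_iff, ExtSetup.mem_S_iff] at h
    omega
  -- the port
  -- the port: the first entry of the far path into `D̄` (its last vertex `wfar` lies over `D`)
  have hwL : wfar ∈ Lfar := by
    have := hLfar.last_mem hLfar.ne_nil
    rw [Set.mem_singleton_iff] at this
    rw [← this]; exact List.getLast_mem _
  have hwfarD : planar k wfar ∈ D := by
    refine ExtSetup.mem_Dbox_iff.2 ⟨(hLfar.subset wfar hwL).1, sqBox_mono _ (by omega : 1 ≤ r) ?_⟩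
    exact planar_mem_sqBox_one_of_adj hwv.symm
  have hheadL : Lfar.head hLfar.ne_nil = c₀ := by
    have := hLfar.head_mem hLfar.ne_nil
    rwa [Set.mem_singleton_iff] at this
  have hheadD : planar k (Lfar.head hLfar.ne_nil) ∉ D := by rw [hheadL]; exact hc₀D
  obtain ⟨mfar, w', restfar, hmfar, hLeqfar, hmfarD, hw'D, hedgefar, -, -, hconnfar, -⟩ :=
    exists_entry (R := E.R) hLfar.chain hLfar.nodup (fun x hx => (hLfar.subset x hx).1) hLfar.ne_nil hheadD
      ⟨wfar, hwL, hwfarD⟩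
  rw [hheadL] at hconnfar
  set q₁ := mfar.getLast hmfar with hq₁def
  have hadj : (slabGraph 3 k).Adj w' q₁ := ((SimpleGraph.mem_edgeSet _).1 (hω hedgefar)).symm
  have hq₁D : planar k q₁ ∉ D := hmfarD _ (List.getLast_mem hmfar)
  have hσ : ω ∈ openConnIn (slabLift k (E.Q.R \ D)) q₁ c₀ := openConnIn_reverse hconnfar
  have hw'far : ¬Near k (E.Q.γ k ω) ρ (planar k w') := (hLfar.subset w' (by rw [hLeqfar]; simp)).2
  -- a vertex of `γ` over `D` other than the last
  obtain ⟨g₀, hg₀, hz⟩ := hnear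
  have hg₀z : planar k g₀ ∈ sqBox z ρ := GlueGeom.mem_sqBox_comm hz
  have hg₀h := ne_head_of_far_A (Q := E.Q) hA hz (by omega : ρ ≤ ρ + 3) hnA
  have hin : ∃ x ∈ E.Q.γ k ω, planar k x ∈ D ∧ x ≠ (E.Q.γ k ω).getLast hγO.ne_nil := by
    by_cases hlast : g₀ = (E.Q.γ k ω).getLast hγO.ne_nil
    · obtain ⟨u, huγ, hadj₀, -, hul⟩ := exists_pred hω hA hg₀ hg₀h
      refine ⟨u, huγ, ExtSetup.mem_Dbox_iff.2 ⟨E.S_subset_R (hγO.subset u huγ),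
        sqBox_mono _ (by omega : ρ + 1 ≤ r) ?_⟩, hul⟩
      exact mem_sqBox_add hg₀z (planar_mem_sqBox_one_of_adj hadj₀.symm)
    · exact ⟨g₀, hg₀, ExtSetup.mem_Dbox_iff.2 ⟨E.S_subset_R (hγO.subset g₀ hg₀),
        sqBox_mono _ (by omega) hg₀z⟩, hlast⟩
  -- the decomposition at the first vertex over `D`
  obtain ⟨p₀, E₁, rest, hγeq, hp₀, hrest, hp₀D, hE₁D⟩ := exists_decompB (Q := E.Q) hA hDA hin
  have hE₁γ : E₁ ∈ E.Q.γ k ω := by rw [hγeq]; simp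
  have hE₁B : planar k E₁ ∉ E.B := by
    intro hB'
    have hex : ∃ l, IsOSAP k ω (slabLift k E.Q.S) (slabLift k E.Q.A) (slabLift k E.Q.B) l :=
      (mem_slabConn_iff_exists_isOSAP ω _ _ _).1 hA
    have h := minPath_prefix_getLast_not_mem E.Q.S_finite hex (p := p₀ ++ [E₁]) (s := rest)
      (by rw [show minPath k ω _ _ _ = E.Q.γ k ω from rfl, hγeq]; simp) hrest (by simp)
    simp at h
    exact h hB'
  have hE₁S : planar k E₁ ∈ E.S := hγO.subset E₁ hE₁γ
  have hE₁K : planar k E₁ ∈ K :=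
    ExtSetup.mem_Kbox_of hE₁S (hDz hE₁D) (fun hb => hE₁B ⟨hE₁S, hb⟩)
  set e₁ := planar k E₁ with he₁def
  set ew := planar k w' with hewdef
  set h : ℕ := ht w' with hhdef
  have hhk : h ≤ k := ht_le w'
  obtain ⟨hw1, hw2, hw3, hw4, hw5, hw6, hw7, hw8⟩ := memD _ hw'D
  -- the rows of the trunk box
  set rB : ℤ := max E.c (z.2 - r) with hrBdef
  set rP : ℤ := min E.d (z.2 + r) with hrPdef
  have hrows : rB + 3 ≤ rP := by
    simp only [hrBdef, hrPdef, max_add, le_min_iff, max_le_iff]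
    omega
  -- the anchor row and the row of `β`
  obtain ⟨ya, hya1, hya2, hyae, -, -⟩ := exists_row_avoid hrows e₁.2 e₁.2 e₁.2
  obtain ⟨yβ, hyβ1, hyβ2, hyβe, hyβa, hyβw⟩ := exists_row_avoid hrows e₁.2 ya ew.2
  have hya : E.c ≤ ya ∧ ya ≤ E.d ∧ z.2 - r ≤ ya ∧ ya ≤ z.2 + r := by
    simp only [hrBdef, hrPdef, max_le_iff, le_min_iff] at hya1 hya2; omega
  have hyβ : E.c ≤ yβ ∧ yβ ≤ E.d ∧ z.2 - r ≤ yβ ∧ yβ ≤ z.2 + r := by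
    simp only [hrBdef, hrPdef, max_le_iff, le_min_iff] at hyβ1 hyβ2; omega
  -- the height of `β`: not the port's
  set hβ : ℕ := if h = 0 then 1 else 0 with hhβdef
  have hhβk : hβ ≤ k := by rw [hhβdef]; split_ifs <;> omega
  have hhβne : hβ ≠ h := by rw [hhβdef]; split_ifs with h' <;> omega
  set β : slab 3 k := vtx k (E.b, yβ) hβ with hβdef
  set β' : slab 3 k := vtx k (E.b - 1, yβ) hβ with hβ'def
  have hβp : planar k β = (E.b, yβ) := planar_vtx _ _
  have hβ'p : planar k β' = (E.b - 1, yβ) := planar_vtx _ _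
  have hβht : ht β = hβ := ht_vtx hhβk _
  have hβS : planar k β ∈ E.S := by
    rw [hβp, ExtSetup.mem_S_iff]; dsimp only; omega
  have hβB : planar k β ∈ E.B := ⟨hβS, by rw [hβp]⟩
  have hβD : planar k β ∈ D := by
    rw [hβp]; refine memD' _ ?_ ?_ ?_ ?_ ?_ ?_ ?_ ?_ <;> dsimp only <;> omega
  have hβ'K : planar k β' ∈ K := by
    rw [hβ'p]; refine memK _ ?_ ?_ ?_ ?_ ?_ ?_ ?_ ?_ <;> dsimp only <;> omega
  have hadjβ : (slabGraph 3 k).Adj β' β := by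
    refine adj_of_planarAdj (by rw [hβdef, hβ'def, ht_vtx hhβk, ht_vtx hhβk]) ?_
    rw [hβp, hβ'p]
    exact planarAdj_left (by simp) (by simp)
  have hE₁β' : E₁ ≠ β' := by
    intro hE
    have := congrArg (fun v => (planar k v).2) hE
    simp only [hβ'p] at this
    exact hyβe (by rw [he₁def, this])
  have hE₁β : E₁ ≠ β := fun hE => hE₁B (by rw [he₁def, hE]; exact hβB)
  have notK_L : ∀ {L : List (slab 3 k)}, (∀ v ∈ L, planar k v ∈ K) → β ∉ L := fun hL hm =>
    notK_b _ (by rw [hβp]) (hL β hm)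
  -- the route: trunk `E₁ → β'` in `K`, branch to `w'` inside `D`
  obtain ⟨L, Br₁, c, spec₁, hLK, hβBr₁⟩ : ∃ L Br₁ c, RouteSpec k D D E₁ β' w' L Br₁ c ∧
      (∀ v ∈ L, planar k v ∈ K) ∧ β ∉ Br₁ := by
    by_cases hcase : ew.1 ≤ E.b - 1
    · -- the port lies left of the column `x = b`: route to it directly (branch box `Kp`)
      have hw'Kp : planar k w' ∈ Kp := by
        rw [ExtSetup.mem_Kplus_iff]
        exact ⟨(ExtSetup.mem_Dbox_iff.1 hw'D).1, (ExtSetup.mem_Dbox_iff.1 hw'D).2, hcase⟩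
      have h0 : ¬Near k (E.Q.γ k ω) 0 (planar k w') := fun hn => hw'far (hn.mono (by omega))
      have hE₁w' : planar k E₁ ≠ planar k w' := (ne_planar_of_not_near h0 hE₁γ).symm
      have hβ'w' : planar k β' ≠ planar k w' := by
        intro hE
        have := congrArg Prod.snd hE
        rw [hβ'p] at this
        exact hyβw (by rw [hewdef, ← this])
      obtain ⟨L, Br, c, spec⟩ := exists_route (xL := max E.a (z.1 - (r : ℕ)))
        (xR' := min (E.b - 1) (z.1 + (r : ℕ))) (xR := min (E.b - 1) (z.1 + (r : ℕ)))
        (rB := max E.c (z.2 - (r : ℕ))) (rP := min E.d (z.2 + (r : ℕ))) (rT := min E.d' (z.2 + (r : ℕ)))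
        hk (by omega) le_rfl (by omega) (by omega) hE₁K hβ'K hw'Kp hE₁β' hE₁w' hβ'w'
      refine ⟨L, Br, c, RouteSpec.mono spec hKD hKpD, spec.hL_sub, fun hm => ?_⟩
      have := spec.hBr_sub β hm
      rw [hβp, mem_boxR_iff] at this
      simp only [max_le_iff, le_min_iff] at this
      omega
    · -- the port lies on or right of the column `x = b`: anchor on `x = b - 1`, exterior L-path
      push Not at hcase
      have hcase' : E.b ≤ ew.1 := by omega
      set w'' : slab 3 k := vtx k (E.b - 1, ya) h with hw''def
      have hw''p : planar k w'' = (E.b - 1, ya) := planar_vtx _ _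
      have hw''K : planar k w'' ∈ K := by
        rw [hw''p]; refine memK _ ?_ ?_ ?_ ?_ ?_ ?_ ?_ ?_ <;> dsimp only <;> omega
      have hE₁w'' : planar k E₁ ≠ planar k w'' := by
        intro hE
        have := congrArg Prod.snd hE
        rw [hw''p] at this
        exact hyae (by rw [he₁def, this])
      have hβ'w'' : planar k β' ≠ planar k w'' := by
        intro hE
        have := congrArg Prod.snd hE
        rw [hβ'p, hw''p] at this
        exact hyβa this
      obtain ⟨L, Br, c, spec⟩ := exists_route (xL := max E.a (z.1 - (r : ℕ)))
        (xR' := min (E.b - 1) (z.1 + (r : ℕ))) (xR := min (E.b - 1) (z.1 + (r : ℕ)))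
        (rB := max E.c (z.2 - (r : ℕ))) (rP := min E.d (z.2 + (r : ℕ))) (rT := min E.d (z.2 + (r : ℕ)))
        hk (by omega) le_rfl (by omega) le_rfl hE₁K hβ'K hw''K hE₁β' hE₁w'' hβ'w''
      have spec' : RouteSpec k K D E₁ β' w'' L Br c := RouteSpec.mono spec subset_rfl hKD
      -- the exterior L-path from `(b, ya)` to `planar w'`, at height `h`
      obtain ⟨lp, hlp, hlpmem⟩ := exists_lpath_hv ((E.b, ya) : ℤ × ℤ) ew
      set X : List (slab 3 k) := liftH k h lp with hXdef
      have hXne : X ≠ [] := liftH_ne_nil hlp.ne_nil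
      have hXcol : ∀ x ∈ X, E.b ≤ (planar k x).1 ∧ ht x = h := by
        intro x hx
        rw [hXdef, mem_liftH_iff hhk] at hx
        refine ⟨?_, hx.2⟩
        rcases (hlpmem _).1 hx.1 with ⟨-, h2, -⟩ | ⟨h1, -, -⟩
        · simp only at h2; rw [min_eq_left hcase'] at h2; exact h2
        · rw [h1]; exact hcase'
      have hXK : ∀ x ∈ X, planar k x ∉ K := fun x hx => notK_b _ (hXcol x hx).1
      have hXD : ∀ x ∈ X, planar k x ∈ D := by
        intro x hx
        rw [hXdef, mem_liftH_iff hhk] at hx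
        rcases (hlpmem _).1 hx.1 with ⟨h1, h2, h3⟩ | ⟨h1, h2, h3⟩
        · simp only at h1 h2 h3
          refine memD' _ ?_ ?_ ?_ ?_ ?_ ?_ ?_ ?_ <;>
            · rw [min_def] at h2; rw [max_def] at h3; split_ifs at h2 h3 <;> omega
        · simp only at h1 h2 h3
          refine memD' _ ?_ ?_ ?_ ?_ ?_ ?_ ?_ ?_ <;>
            · rw [min_def] at h2; rw [max_def] at h3; split_ifs at h2 h3 <;> omega
      have hXhead : X.head? = some (vtx k (E.b, ya) h) := by
        rw [hXdef, head?_liftH, hlp.head]; rfl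
      have hXlast : X.getLast hXne = w' := by
        apply Option.some_injective
        rw [← List.getLast?_eq_some_getLast, hXdef, getLast?_liftH, hlp.last]
        simp [hewdef, hhdef, vtx_planar_ht]
      have hchX : (w'' :: X).IsChain (fun a b => (slabGraph 3 k).Adj a b) := by
        rw [List.isChain_cons]
        refine ⟨fun y hy => ?_, liftH_isChain h hlp.chain⟩
        rw [hXhead] at hy
        simp only [Option.mem_def, Option.some.injEq] at hy
        rw [← hy, hw''def]
        exact vtx_adj_vtx_planar (planarAdj_left (by simp) (by simp)) h
      have hXL : ∀ x ∈ X, x ∉ L := fun x hx hm => hXK x hx (spec.hL_sub x hm)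
      have hXBr : ∀ x ∈ X, x ∉ c :: Br := by
        intro x hx hm
        rcases List.mem_cons.1 hm with hm | hm
        · exact hXK x hx (hm ▸ spec.hL_sub c spec.hc)
        · exact hXK x hx (spec.hBr_sub x hm)
      have spec₂ := RouteSpec.append_branch X w'' Br hXne spec' hchX (liftH_nodup hlp.nodup) hXL hXBr hXD
      rw [hXlast] at spec₂
      refine ⟨L, Br ++ X, c, RouteSpec.mono spec₂ hKD subset_rfl, spec.hL_sub, fun hm => ?_⟩
      rcases List.mem_append.1 hm with hm | hm
      · exact notK_b _ (by rw [hβp]) (spec.hBr_sub β hm)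
      · exact hhβne (hβht ▸ (hXcol β hm).2)
  -- the trunk ends at `β`
  have spec₃ : RouteSpec k D D E₁ β w' (L ++ [β]) Br₁ c :=
    RouteSpec.concat_trunk spec₁ subset_rfl hadjβ (notK_L hLK) hβBr₁ hβD
  have hint : ∀ v ∈ L ++ [β], v ≠ E₁ → v ≠ β → planar k v ∈ E.Q.S ∧ planar k v ∉ E.Q.B := by
    intro v hv _ hvβ
    rcases List.mem_append.1 hv with hv | hv
    · exact ⟨ExtSetup.Kbox_subset_S _ _ (hLK v hv), ExtSetup.Kbox_disjoint_B (hLK v hv)⟩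
    · exact absurd (List.mem_singleton.1 hv) hvβ
  obtain ⟨sb, hsb⟩ := exists_surgeryB_of_decomp (Q := E.Q) (ExtSetup.Dbox_subset_R _ _) hDA hγeq hp₀
    hrest hp₀D hE₁D hE₁β hβD hβS hβB hadj hq₁D hc₀ hσ spec₃ hint
  exact ⟨sb, hsb ▸ hDz⟩

/-- A `B`-reaching surgery with cleared set inside `y + B_r` is a located gadget at `y` (type `att`).
[cite: NewmanTassionWu2017, §3.2 (proof of Theorem 3.7)] -/
theorem gadgetAt_of_surgeryB {Q : GlueData} {r : ℕ} {y : ℤ × ℤ} (hX : ω ∈ Q.evX k)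
    (sb : Q.SurgeryB k ω) (hD : sb.D ⊆ sqBox y r) : GadgetAt Q k r ω sb.newConfig y :=
  ⟨sb.newConfig_mem_evCA hX, fun _ he => sb.mem_window hX.1 he,
    ⟨sb.D, fun _ he => sb.agree_off_touch he, hD, 0, by
      simpa [statOf] using sb.att_nonempty hX, by simpa [statOf] using sb.att_subset hX⟩⟩

end AtB

end NTW17

end Literature.Probability.Percolation

end
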